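import Summits.MatrixMultiplication.MatrixMultiplication.Theorems.SoloInformedTriangularDoor
import Summits.MatrixMultiplication.MatrixMultiplication.Theorems.SoloInformedTTwoDoor
import Summits.MatrixMultiplication.MatrixMultiplication.Theorems.SoloInformedTriangularThreeBini
import Summits.MatrixMultiplication.MatrixMultiplication.Theorems.StrassenDefectDefectInequality
import Literature.Computability.AlgebraicComplexity.PrattTripartitionBoundsProofs
import HarnessLib

/-!
# `R̃(s + t) ≤ R̃(s) + R̃(t)`, the Peirce split `R̃(T(U₃)) ≤ R̃(T₂) + 6`, and the rung-3 window `6 ≤ R̃(T(U₃)) ≤ 9`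

Solo-informed seat (gen 30), paper §2q(3), part 4 (after `SoloInformedSchonhageAsymptotic`,
`SoloInformedTriangularDoor`, `SoloInformedTTwoDoor`, and using part 5 `SoloInformedTriangularThreeBini`).

Rung `k = 3` of the triangular family is the tensor `T(U₃) = ⟨3,3,3⟩_{U₃,U₃}` (the structure
tensor of the algebra of upper triangular `3 × 3` matrices, format `6³` after concision; rank
`R(T(U₃)) = 10` [BurgisserClausenShokrollahi1997, Ex. 17.24*], border rank `≥ 8`
[ibid., Cor. (19.14)] — neither formalised here).  Part 2 proves `6 ≤ R̃(T(U₃))` (flattening)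
and that the door value `R̃(T(U₃)) ≤ 6` would give `ω < 2.335`; part 5 proves `bR(T(U₃)) ≤ 9`
(BCLR inside `U₃`).  This file proves, over every field,

  `R̃(T(U₃)) ≤ R̃(T₂) + 6 ≤ √14 + 6`   (Peirce split)   and the window   `6 ≤ R̃(T(U₃)) ≤ 9 < 10`.

Mechanism (the Peirce split along the idempotent `E₂₂`): the multiplication table of `U₃`
(chains `i ≤ j ≤ l` in `{0,1,2}`: `E_{ij}E_{jl} = E_{il}`) is the table of the corner
`U₂ = ⟨E₀₀, E₀₁, E₁₁⟩` (chains with `l ≤ 1`) PLUS the action of `U₃` on its last column (the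
six chains with `l = 2`), a tensor of rank `≤ 6`.  The asymptotic rank is subadditive under `+`
— a sum is a restriction of the direct sum, and `R̃(s ⊕ t) ≤ R̃(s) + R̃(t)` holds by Strassen
duality (`asymptoticRank_directSumTensor_le_add`, in the tree) — and `R̃(T(U₂)) = R̃(T₂) ≤ √14`
(parts 3 and `SoloInformedCwTwoShadow`: the Bini certificate `bR(T₂ ⊠ T₂) ≤ 14`).
The same split gives `R̃(T(U_{k+1})) ≤ R̃(T(U_k)) + (k+1)(k+2)/2` in general (not formalised).
No single rung is a door to `ω = 2`: `T(U_k)` is the structure tensor of a NON-SEMISIMPLE algebra,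
hence irreversible [BlaserLysikov2020, Cor. 23], and no bounded-dimensional family of such
tensors proves `ω = 2` [BlaserLysikov2020, Cor. 24]; the family `k → ∞` restates the summit
(part 2, `matrixMultiplication_iff_triangular`).

## Main statements
* `directSumTensor_restrictsTo_add` — `s ⊕ t ≥ s + t` (the codiagonal restriction);
* `asymptoticRank_add_le` — **`R̃(s + t) ≤ R̃(s) + R̃(t)`** over every field;
* `triangular_three_eq_corner_add_column` — the Peirce split of the table of `U₃`;
* `asymptoticRank_triangular_three_le` — **`R̃(T(U₃)) ≤ R̃(T₂) + 6`**;
* `algBorderRank_triangular_three_le_nine`, `asymptoticRank_triangular_three_le_nine`,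
  `asymptoticRank_triangular_three_window` — **`bR(T(U₃)) ≤ 9`, `6 ≤ R̃(T(U₃)) ≤ 9`** (the BCLR
  certificate of part 5, `SoloInformedTriangularThreeBini`; the Peirce bound is `≥ 9`).

## References
* [BurgisserClausenShokrollahi1997] P. Bürgisser, M. Clausen, M. A. Shokrollahi, *Algebraic
  Complexity Theory*, Springer 1997: §15.9 (partial matrix multiplication), Ex. 17.24*
  (`R(T_n)`, `T_n` of minimal rank iff `n = 2`), Cor. (19.14) (`bR(T_m) ≥ m(3m+1)/4`).
* [ChristandlVranaZuiddam2023] M. Christandl, P. Vrana, J. Zuiddam, *Universal points in the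
  asymptotic spectrum of tensors*, J. AMS 36 (2023), §1.1 (restriction, direct sum), Prop. 1.6 /
  Strassen's duality (additivity of spectral points).
* [Blaser2013] M. Bläser, *Fast Matrix Multiplication*, ToC Graduate Surveys 5 (2013), §4
  (triads, `R(t) ≤` number of terms), Lemma 5.4 (restriction).
* [Alman2021] J. Alman, Theory of Computing 17 (2021), §2.4 (`R̃` monotone under degeneration).
* [BlaserLysikov2020] M. Bläser, V. Lysikov, *Slice rank of block tensors and irreversibility of
  structure tensors of algebras*, MFCS 2020, LIPIcs 170:17, Cor. 23, Cor. 24, Rem. 26.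
-/

noncomputable section

open scoped BigOperators

namespace Summit.MatrixMultiplication.MatrixMultiplication.Theorems

open Literature.Computability.AlgebraicComplexity
open Literature.Barriers.MatrixMultiplication (asymptoticRank_le_of_polyDegeneratesTo)

/-! ## Subadditivity of the asymptotic rank under `+` -/

section AddLe

variable {K : Type*} [Field K] {ι κ μ : Type*}

/-- A mixed position of a direct sum vanishes. [folklore] -/
private theorem directSumTensor_inl_inl_inr (s t : ι → κ → μ → K) (a : ι) (b : κ) (c : μ) :
    directSumTensor s t (Sum.inl a) (Sum.inl b) (Sum.inr c) = 0 := rfl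

/-- A mixed position of a direct sum vanishes. [folklore] -/
private theorem directSumTensor_inr_inr_inl (s t : ι → κ → μ → K) (a : ι) (b : κ) (c : μ) :
    directSumTensor s t (Sum.inr a) (Sum.inr b) (Sum.inl c) = 0 := rfl

variable [Fintype ι] [Fintype κ] [Fintype μ] [DecidableEq ι] [DecidableEq κ] [DecidableEq μ]

/-- A triple indicator sum evaluates. [folklore] -/
private theorem sum_indicator₃ (f : ι → κ → μ → K) (a' : ι) (b' : κ) (c' : μ) :
    ∑ a, ∑ b, ∑ c, (if a = a' then (1 : K) else 0) * (if b = b' then (1 : K) else 0) *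
      (if c = c' then (1 : K) else 0) * f a b c = f a' b' c' := by
  rw [Finset.sum_eq_single a' (fun a _ ha => by simp [ha]) (by simp),
    Finset.sum_eq_single b' (fun b _ hb => by simp [hb]) (by simp),
    Finset.sum_eq_single c' (fun c _ hc => by simp [hc]) (by simp)]
  simp

/-- **`s ⊕ t ≥ s + t`**: a sum of two tensors of the same format is the restriction of their
direct sum along the codiagonal maps `K^{ι ⊕ ι} → K^ι`. [cite: ChristandlVranaZuiddam2023, §1.1] -/
theorem directSumTensor_restrictsTo_add (s t : ι → κ → μ → K) :
    TensorRestrictsTo (directSumTensor s t) (s + t) := by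
  refine ⟨fun a' => Sum.elim (fun a => if a = a' then (1 : K) else 0)
      (fun a => if a = a' then (1 : K) else 0),
    fun b' => Sum.elim (fun b => if b = b' then (1 : K) else 0)
      (fun b => if b = b' then (1 : K) else 0),
    fun c' => Sum.elim (fun c => if c = c' then (1 : K) else 0)
      (fun c => if c = c' then (1 : K) else 0), fun a' b' c' => ?_⟩
  simp only [Fintype.sum_sum_type, Sum.elim_inl, Sum.elim_inr, directSumTensor_inl,
    directSumTensor_inr, directSumTensor_inl_inr, directSumTensor_inr_inl,
    directSumTensor_inl_inl_inr, directSumTensor_inr_inr_inl, mul_zero, Finset.sum_const_zero,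
    add_zero, zero_add, sum_indicator₃]
  rfl

end AddLe

/-- **Subadditivity `R̃(s + t) ≤ R̃(s) + R̃(t)`** over every field: `s ⊕ t ≥ s + t`
(`directSumTensor_restrictsTo_add`), `R̃` is monotone under restriction, and
`R̃(s ⊕ t) ≤ R̃(s) + R̃(t)` (Strassen duality, `asymptoticRank_directSumTensor_le_add`).
[cite: ChristandlVranaZuiddam2023, §1.1] -/
theorem asymptoticRank_add_le {K : Type} [Field K] {ι κ μ : Type} [Fintype ι] [Fintype κ]
    [Fintype μ] [DecidableEq ι] [DecidableEq κ] [DecidableEq μ] (s t : ι → κ → μ → K) :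
    asymptoticRank (s + t) ≤ asymptoticRank s + asymptoticRank t :=
  (asymptoticRank_le_of_polyDegeneratesTo
      (directSumTensor_restrictsTo_add s t).polyDegeneratesTo).trans
    (asymptoticRank_directSumTensor_le_add s t)

/-! ## The Peirce split of `T(U₃)` -/

/- NOTATION (no new definitions).  `cl` : the retraction `[3]² → [2]²` folding coordinate `2`
onto `1` (the identity on the corner block `{0,1}²`); `corT[K]` : the corner part of the table of
`U₃` = `T(U₂)` pulled back along `cl` and cut off by the `0/1` guards of the corner block on all
three legs; `colA/colB/colC` : the positions `(z, x, y) = (E_{i2}, E_{ij}, E_{j2})` of the six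
column chains `i ≤ j ≤ 2`; `colT[K]` : their sum as six triads. -/
set_option quotPrecheck false in
local notation "cl" => (fun p : Fin 3 × Fin 3 =>
  ((if p.1 = 0 then (0 : Fin 2) else 1), (if p.2 = 0 then (0 : Fin 2) else 1)))
set_option quotPrecheck false in
local notation "corT[" K "]" => (fun a b c : Fin 3 × Fin 3 =>
  (if a.1 ≠ 2 ∧ a.2 ≠ 2 then (1 : K) else 0) * (if b.1 ≠ 2 ∧ b.2 ≠ 2 then (1 : K) else 0) *
    (if c.1 ≠ 2 ∧ c.2 ≠ 2 then (1 : K) else 0) * triangularTensor K 2 (cl a) (cl b) (cl c))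
local notation "colA" => (![(0, 2), (0, 2), (0, 2), (1, 2), (1, 2), (2, 2)] : Fin 6 → Fin 3 × Fin 3)
local notation "colB" => (![(0, 0), (0, 1), (0, 2), (1, 1), (1, 2), (2, 2)] : Fin 6 → Fin 3 × Fin 3)
local notation "colC" => (![(0, 2), (1, 2), (2, 2), (1, 2), (2, 2), (2, 2)] : Fin 6 → Fin 3 × Fin 3)
set_option quotPrecheck false in
local notation "colT[" K "]" => (∑ s : Fin 6, triad (Pi.single (colA s) (1 : K))
  (Pi.single (colB s) (1 : K)) (Pi.single (colC s) (1 : K)))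

section Split

set_option maxRecDepth 8192 in
/-- The Peirce split of the multiplication table of `U₃` as a decidable identity of integer
tensors: chains `i ≤ j ≤ l` with `l ≤ 1` (the corner `U₂`, read through `cl` on the corner
block) plus the six chains with `l = 2`. [cite: BurgisserClausenShokrollahi1997, §15.9] -/
private theorem triangular_three_tableInt (a b c : Fin 3 × Fin 3) :
    (if ((b ∈ upperPattern 3 ∧ c ∈ upperPattern 3) ∧ (a.1 = b.1 ∧ b.2 = c.1 ∧ a.2 = c.2))
      then (1 : ℤ) else 0) =
    (if a.1 ≠ 2 ∧ a.2 ≠ 2 then (1 : ℤ) else 0) * (if b.1 ≠ 2 ∧ b.2 ≠ 2 then (1 : ℤ) else 0) *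
      (if c.1 ≠ 2 ∧ c.2 ≠ 2 then (1 : ℤ) else 0) *
      (if ((cl b ∈ upperPattern 2 ∧ cl c ∈ upperPattern 2) ∧
          ((cl a).1 = (cl b).1 ∧ (cl b).2 = (cl c).1 ∧ (cl a).2 = (cl c).2))
        then (1 : ℤ) else 0) +
    ∑ s : Fin 6, (if a = colA s then (1 : ℤ) else 0) * (if b = colB s then (1 : ℤ) else 0) *
      (if c = colC s then (1 : ℤ) else 0) := by
  revert a b c
  decide

variable (K : Type) [Field K]

/-- **The Peirce split `T(U₃) = corner + column`**: `T(U₃) = corT + colT` as tensors in the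
format `(3²)³`. [cite: BurgisserClausenShokrollahi1997, §15.9] -/
theorem triangular_three_eq_corner_add_column : triangularTensor K 3 = corT[K] + colT[K] := by
  funext a b c
  simp only [Pi.add_apply, Finset.sum_apply, triad_apply, Pi.single_apply, triangularTensor,
    partialMatMulTensor_apply]
  have h := congrArg (Int.cast : ℤ → K) (triangular_three_tableInt a b c)
  push_cast at h
  exact h

/-- The corner part is a restriction of `T(U₂)`, so **`R̃(corT) ≤ R̃(T(U₂)) = R̃(T₂)`**.
[cite: Blaser2013, Lemma 5.4] -/
theorem asymptoticRank_corner_le : asymptoticRank corT[K] ≤ asymptoticRank (tTwo K) := by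
  have h := asymptoticRank_le_of_polyDegeneratesTo
    (tensorRestrictsTo_precomp_guard K (triangularTensor K 2) cl cl cl
      (fun p : Fin 3 × Fin 3 => if p.1 ≠ 2 ∧ p.2 ≠ 2 then (1 : K) else 0)
      (fun p : Fin 3 × Fin 3 => if p.1 ≠ 2 ∧ p.2 ≠ 2 then (1 : K) else 0)
      (fun p : Fin 3 × Fin 3 => if p.1 ≠ 2 ∧ p.2 ≠ 2 then (1 : K) else 0)).polyDegeneratesTo
  exact h.trans (le_of_eq (asymptoticRank_triangular_two K))

/-- The column part is a sum of six triads, so **`R(colT) ≤ 6`**. [cite: Blaser2013, §4] -/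
theorem tensorRank_column_le : tensorRank colT[K] ≤ 6 :=
  (tensorRank_le_card_of_eq_sum _ _ _ rfl).trans (by simp)

/-- **`R̃(colT) ≤ 6`** (`R̃ ≤ R`). [cite: Blaser2013, §4] -/
theorem asymptoticRank_column_le : asymptoticRank colT[K] ≤ 6 :=
  (asymptoticRank_le_tensorRank _).trans (by exact_mod_cast tensorRank_column_le K)

end Split

/-! ## The window for rung `k = 3` -/

section Window

variable (K : Type) [Field K]

/-- **`R̃(T(U₃)) ≤ R̃(T₂) + 6`** over every field (Peirce split + subadditivity).
[cite: ChristandlVranaZuiddam2023, §1.1] -/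
theorem asymptoticRank_triangular_three_le :
    asymptoticRank (triangularTensor K 3) ≤ asymptoticRank (tTwo K) + 6 := by
  rw [triangular_three_eq_corner_add_column K]
  exact (asymptoticRank_add_le _ _).trans
    (add_le_add (asymptoticRank_corner_le K) (asymptoticRank_column_le K))

/-- **`R̃(T(U₃)) ≤ √14 + 6`** over every field (`R̃(T₂) ≤ √14`, the Bini certificate
`bR(T₂ ⊠ T₂) ≤ 14`). [cite: BurgisserClausenShokrollahi1997, Ex. 17.24*] -/
theorem asymptoticRank_triangular_three_le_sqrt :
    asymptoticRank (triangularTensor K 3) ≤ Real.sqrt 14 + 6 :=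
  (asymptoticRank_triangular_three_le K).trans
    (add_le_add (asymptoticRank_tTwo_le_sqrt_fourteen K) le_rfl)

/-- `|U₃| = 6`. [folklore] -/
theorem card_upperPattern_three : (upperPattern 3).card = 6 := by
  have h := two_mul_card_upperPattern 3
  omega

/-- **`bR(T(U₃)) ≤ 9`** in the notation of part 2 (`triangularTensor K 3 = ⟨3,3,3⟩_{U₃,U₃}`, by
definition): the BCLR certificate of `SoloInformedTriangularThreeBini`.
[cite: BurgisserClausenShokrollahi1997, §15.2] -/
theorem algBorderRank_triangular_three_le_nine : algBorderRank (triangularTensor K 3) ≤ 9 :=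
  algBorderRank_partialMatMul_upper_three_le_nine K

/-- **`R̃(T(U₃)) ≤ 9`** over every field — below the Peirce bound `R̃(T₂) + 6 ≥ 9`
(`R̃(T₂) ≥ 3` by flattening), which therefore can never beat Bini's packing at rung `3`.
[cite: BurgisserClausenShokrollahi1997, §15.2] -/
theorem asymptoticRank_triangular_three_le_nine : asymptoticRank (triangularTensor K 3) ≤ 9 :=
  asymptoticRank_partialMatMul_upper_three_le_nine K

/-- **The rung-3 window `6 ≤ R̃(T(U₃)) ≤ 9`** over every field — strictly below the rank
`R(T₃) = 10` (BCS Ex. 17.24*); `R̃(T(U₃)) ≤ 6` would give `ω < 2.335` (part 2), the record needs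
`< 6.17`, and `8 ≤ bR(T₃(ℂ)) ≤ 9` (BCS Cor. (19.14) and part 5).
[cite: BurgisserClausenShokrollahi1997, Ex. 17.24*] -/
theorem asymptoticRank_triangular_three_window :
    (6 : ℝ) ≤ asymptoticRank (triangularTensor K 3) ∧
      asymptoticRank (triangularTensor K 3) ≤ 9 := by
  refine ⟨?_, asymptoticRank_triangular_three_le_nine K⟩
  have h := card_upperPattern_le_asymptoticRank_triangular K 3
  rw [card_upperPattern_three] at h
  exact_mod_cast h

end Window

end Summit.MatrixMultiplication.MatrixMultiplication.Theorems
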